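import Summits.Ventures.HSemireg.WedgeHankelRecurrenceGaussChebyshevDerivativesNonneg

/-!
# Venture HSemireg — **EVERY DERIVATIVE OF `S_n, C_n` (resp. `T_n, U_n`) IS MINIMAL AT THE ENDPOINT: `P^{(k)}(2) ≤ P^{(k)}(x)` for `x ≥ 2` (resp. `P^{(k)}(1) ≤ P^{(k)}(x)` for `x ≥ 1`), and `P_n^{(k)}(x) > 0` there
# for `k ≤ n`** (Taylor coefficients `≥ 0` at the endpoint give `k!·(P(X+a))_k ≤ P^{(k)}(x)`; the endpoint values are the positive binomials of N551)

HONEST FRAMING. Part of the Lean index of the computation cell `pub-hsemireg` (seat p10 gen 49, Sunday typer «UNIFORM-IN-n»).  Polynomial algebra with the formal derivative and real inequalities (Mathlib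
`Polynomial.derivative`, `coeff_X_add_C_pow`, `Polynomial.Chebyshev.T ∕ U ∕ C ∕ S`); no variety, no cohomology theory, no sheaf, no Ext group and no semiregularity map is constructed here; nothing here says
that HC / HC_CM / HC_AV holds; no Literature fact (unproved `Prop`) is declared or used.  Custodian versions as in `WedgeHankelSiegelIdeal` (1/3).
SOURCES (cited).  T. J. Rivlin, *The Chebyshev Polynomials* (Wiley 1974), §1.5 (1.97)–(1.98), §2.7 (`T_n^{(k)}` increasing and positive on `[1, ∞)`); P. Borwein, T. Erdélyi, *Polynomials and Polynomial
Inequalities* (Springer 1995), §5.1.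
PROOF TYPED HERE.  `(q(X + b))_k = Σ_i q_i C(i,k) b^{i−k} ≥ q_k` when `q_i ≥ 0`, `b ≥ 0` (`comp_eq_sum_left`, `coeff_X_add_C_pow`, `Finset.single_le_sum`); with `q = p(X + a)`, `b = x − a` and N551
`iterate_derivative_eval_eq_factorial_mul_coeff` this is `p^{(k)}(a) = k!·(p(X+a))_k ≤ p^{(k)}(x)`; the endpoint values `S_n^{(k)}(2) = k!·C(n+1+k, 2k+1)` etc. (N551) are positive for `k ≤ n`
(`Nat.choose_pos`).
DEDUP DISCLOSURE (`rg -n 'iterate_derivative.*(le|pos)|derivative\\^\\[.*eval 1 ≤' Summits/Ventures/HSemireg Literature Mathlib…Chebyshev`, 2026-09-05): Mathlib `eval_iterate_derivative_le_of_forall_abs_le_one`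
compares `P^{(k)}(x) ≤ T_n^{(k)}(x)` for `|P| ≤ 1` on `[−1, 1]` (a different comparison), `Literature…ChebyshevSubmultiplicative.abs_iterate_derivative_T_le` compares `T_m^{(k)}` with `T_n^{(k)}`, `m ≤ n`
(cited); N522 (`k = 0` monotonicity), N552 (nonnegativity) are the neighbours; the endpoint-minimum and positivity statements are not typed; 0 hits for the 10 names below.

WHAT IS IN THE TREE.  N552 `coeff_comp_X_add_C_nonneg`; N551 `iterate_derivative_eval_eq_factorial_mul_coeff`, `iterate_derivative_chebyshevS_eval_two`, `iterate_derivative_chebyshevC_eval_two`,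
`iterate_derivative_chebyshevU_eval_one_eq_choose`, `two_mul_iterate_derivative_chebyshevT_eval_one_eq_choose`, `chebyshevU_comp_X_add_one_coeff`, `two_mul_chebyshevT_comp_X_add_one_coeff`; N549
`chebyshevS ∕ C_comp_X_add_two_coeff`; Mathlib `comp_eq_sum_left`, `coeff_X_add_C_pow`, `Finset.single_le_sum`, `Nat.choose_pos`.
THIS FILE (namespace `Summit.Ventures.HSemireg.Wedge.HankelOuter` continued; CHAINED on N552; 0 definitions):
* §1318 `coeff_le_coeff_comp_X_add_C`, `iterate_derivative_eval_le_of_coeff_comp_nonneg` (the criterion `p^{(k)}(a) ≤ p^{(k)}(x)`), **`iterate_derivative_chebyshevS_real_eval_two_le`**,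
  **`iterate_derivative_chebyshevC_real_eval_two_le`**, **`iterate_derivative_chebyshevU_real_eval_one_le`**, **`iterate_derivative_chebyshevT_real_eval_one_le`** (endpoint minimum),
  **`iterate_derivative_chebyshevS_real_eval_pos`**, **`iterate_derivative_chebyshevC_real_eval_pos`**, **`iterate_derivative_chebyshevU_real_eval_pos`**, **`iterate_derivative_chebyshevT_real_eval_pos`**
  (`k ≤ n ⇒ P_n^{(k)}(x) > 0` beyond the endpoint; for `C`, `T` with `n ≥ 1`).
CAVEATS.  `n, k ∈ ℕ`; positivity needs `k ≤ n` (higher derivatives vanish).  Nothing Ext-side.  New names only.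
-/

open Module Polynomial
open scoped Matrix Polynomial Nat

namespace Summit.Ventures.HSemireg.Wedge.HankelOuter

/-! ## §1318. Derivatives are minimal (and positive) at the endpoint -/

/-- If all coefficients of `q ∈ ℝ[X]` are `≥ 0` and `b ≥ 0`, then `q_k ≤ (q(X + b))_k`. [this file, §1318] -/
theorem coeff_le_coeff_comp_X_add_C {q : ℝ[X]} (hq : ∀ k, 0 ≤ q.coeff k) {b : ℝ} (hb : 0 ≤ b) (k : ℕ) : q.coeff k ≤ (q.comp (X + Polynomial.C b)).coeff k := by
  by_cases hk : k ∈ q.support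
  · rw [comp_eq_sum_left, Polynomial.sum_def, finsetSum_coeff]
    have hterm : ∀ i ∈ q.support, 0 ≤ (Polynomial.C (q.coeff i) * (X + Polynomial.C b) ^ i).coeff k := fun i _ => by
      rw [coeff_C_mul, coeff_X_add_C_pow]
      exact mul_nonneg (hq i) (mul_nonneg (pow_nonneg hb _) (Nat.cast_nonneg _))
    refine le_trans (le_of_eq ?_) (Finset.single_le_sum hterm hk)
    rw [coeff_C_mul, coeff_X_add_C_pow, Nat.sub_self, pow_zero, Nat.choose_self, Nat.cast_one, mul_one, mul_one]
  · rw [notMem_support_iff.mp hk]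
    exact coeff_comp_X_add_C_nonneg hq hb k

/-- **If all Taylor coefficients of `p ∈ ℝ[X]` at `a` are `≥ 0`, then `p^{(k)}(a) ≤ p^{(k)}(x)` for `x ≥ a`** (every derivative is minimal at `a` on `[a, ∞)`). [this file, §1318] -/
theorem iterate_derivative_eval_le_of_coeff_comp_nonneg {p : ℝ[X]} {a : ℝ} (h : ∀ k, 0 ≤ (p.comp (X + Polynomial.C a)).coeff k) {x : ℝ} (hx : a ≤ x) (k : ℕ) :
    (derivative^[k] p).eval a ≤ (derivative^[k] p).eval x := by
  have e : p.comp (X + Polynomial.C x) = (p.comp (X + Polynomial.C a)).comp (X + Polynomial.C (x - a)) := by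
    rw [comp_assoc]
    congr 1
    simp only [add_comp, X_comp, C_comp, add_assoc, ← map_add, sub_add_cancel]
  rw [iterate_derivative_eval_eq_factorial_mul_coeff, iterate_derivative_eval_eq_factorial_mul_coeff, e]
  exact mul_le_mul_of_nonneg_left (coeff_le_coeff_comp_X_add_C h (sub_nonneg.mpr hx) k) (Nat.cast_nonneg _)

/-! ### Endpoint minimum -/

/-- **`S_n^{(k)}(2) ≤ S_n^{(k)}(x)` for `x ≥ 2`.** [Rivlin 1974, §2.7 (rescaled); this file, §1318] -/
theorem iterate_derivative_chebyshevS_real_eval_two_le (n k : ℕ) {x : ℝ} (hx : 2 ≤ x) :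
    (derivative^[k] (Polynomial.Chebyshev.S ℝ (n : ℤ))).eval 2 ≤ (derivative^[k] (Polynomial.Chebyshev.S ℝ (n : ℤ))).eval x := by
  have h := iterate_derivative_eval_le_of_coeff_comp_nonneg (p := Polynomial.Chebyshev.S ℝ (n : ℤ)) (a := 2) (fun j => by rw [map_ofNat, chebyshevS_comp_X_add_two_coeff]; exact Nat.cast_nonneg _) hx k
  exact h

/-- **`C_n^{(k)}(2) ≤ C_n^{(k)}(x)` for `x ≥ 2`.** [Rivlin 1974, §2.7 (rescaled); this file, §1318] -/
theorem iterate_derivative_chebyshevC_real_eval_two_le (n k : ℕ) {x : ℝ} (hx : 2 ≤ x) :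
    (derivative^[k] (Polynomial.Chebyshev.C ℝ (n : ℤ))).eval 2 ≤ (derivative^[k] (Polynomial.Chebyshev.C ℝ (n : ℤ))).eval x := by
  match n with
  | 0 =>
    match k with
    | 0 => simp
    | k + 1 => rw [Function.iterate_succ_apply, Nat.cast_zero, Polynomial.Chebyshev.C_zero, derivative_ofNat, iterate_derivative_zero, eval_zero, eval_zero]
  | m + 1 =>
    have h := iterate_derivative_eval_le_of_coeff_comp_nonneg (p := Polynomial.Chebyshev.C ℝ ((m + 1 : ℕ) : ℤ)) (a := 2)
      (fun j => by rw [map_ofNat, chebyshevC_comp_X_add_two_coeff]; positivity) hx k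
    exact h

/-- **`U_n^{(k)}(1) ≤ U_n^{(k)}(x)` for `x ≥ 1`.** [Rivlin 1974, §2.7; this file, §1318] -/
theorem iterate_derivative_chebyshevU_real_eval_one_le (n k : ℕ) {x : ℝ} (hx : 1 ≤ x) :
    (derivative^[k] (Polynomial.Chebyshev.U ℝ (n : ℤ))).eval 1 ≤ (derivative^[k] (Polynomial.Chebyshev.U ℝ (n : ℤ))).eval x := by
  have h := iterate_derivative_eval_le_of_coeff_comp_nonneg (p := Polynomial.Chebyshev.U ℝ (n : ℤ)) (a := 1) (fun j => by rw [map_one, chebyshevU_comp_X_add_one_coeff]; positivity) hx k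
  exact h

/-- **`T_n^{(k)}(1) ≤ T_n^{(k)}(x)` for `x ≥ 1`.** [Rivlin 1974, §2.7; this file, §1318] -/
theorem iterate_derivative_chebyshevT_real_eval_one_le (n k : ℕ) {x : ℝ} (hx : 1 ≤ x) :
    (derivative^[k] (Polynomial.Chebyshev.T ℝ (n : ℤ))).eval 1 ≤ (derivative^[k] (Polynomial.Chebyshev.T ℝ (n : ℤ))).eval x := by
  match n with
  | 0 =>
    match k with
    | 0 => simp
    | k + 1 => rw [Function.iterate_succ_apply, Nat.cast_zero, Polynomial.Chebyshev.T_zero, derivative_one, iterate_derivative_zero, eval_zero, eval_zero]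
  | m + 1 =>
    have h := iterate_derivative_eval_le_of_coeff_comp_nonneg (p := Polynomial.Chebyshev.T ℝ ((m + 1 : ℕ) : ℤ)) (a := 1)
      (fun j => by
        have h2 := two_mul_chebyshevT_comp_X_add_one_coeff (R := ℝ) m j
        rw [map_one]
        have h0 : (0 : ℝ) ≤ 2 ^ j * ((m + 1 + j).choose (2 * j) + (m + j).choose (2 * j) : ℝ) := by positivity
        linarith) hx k
    exact h

/-! ### Positivity for `k ≤ n` -/

/-- **`S_n^{(k)}(x) > 0` for `x ≥ 2` and `k ≤ n`.** [this file, §1318] -/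
theorem iterate_derivative_chebyshevS_real_eval_pos {n k : ℕ} (hk : k ≤ n) {x : ℝ} (hx : 2 ≤ x) : 0 < (derivative^[k] (Polynomial.Chebyshev.S ℝ (n : ℤ))).eval x := by
  refine lt_of_lt_of_le ?_ (iterate_derivative_chebyshevS_real_eval_two_le n k hx)
  rw [iterate_derivative_chebyshevS_eval_two]
  exact_mod_cast Nat.mul_pos (Nat.factorial_pos k) (Nat.choose_pos (by omega))

/-- **`C_n^{(k)}(x) > 0` for `x ≥ 2`, `k ≤ n`, `n ≥ 1`** (and trivially `C_0 = 2 > 0` for `k = 0`). [this file, §1318] -/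
theorem iterate_derivative_chebyshevC_real_eval_pos {n k : ℕ} (hn : 1 ≤ n) (hk : k ≤ n) {x : ℝ} (hx : 2 ≤ x) : 0 < (derivative^[k] (Polynomial.Chebyshev.C ℝ (n : ℤ))).eval x := by
  refine lt_of_lt_of_le ?_ (iterate_derivative_chebyshevC_real_eval_two_le n k hx)
  obtain ⟨m, rfl⟩ : ∃ m, n = m + 1 := ⟨n - 1, by omega⟩
  rw [iterate_derivative_chebyshevC_eval_two]
  exact_mod_cast Nat.mul_pos (Nat.factorial_pos k) (Nat.add_pos_left (Nat.choose_pos (by omega)) _)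

/-- **`U_n^{(k)}(x) > 0` for `x ≥ 1` and `k ≤ n`.** [Rivlin 1974, (1.98); this file, §1318] -/
theorem iterate_derivative_chebyshevU_real_eval_pos {n k : ℕ} (hk : k ≤ n) {x : ℝ} (hx : 1 ≤ x) : 0 < (derivative^[k] (Polynomial.Chebyshev.U ℝ (n : ℤ))).eval x := by
  refine lt_of_lt_of_le ?_ (iterate_derivative_chebyshevU_real_eval_one_le n k hx)
  rw [iterate_derivative_chebyshevU_eval_one_eq_choose]
  exact_mod_cast Nat.mul_pos (Nat.mul_pos (Nat.factorial_pos k) (pow_pos two_pos k)) (Nat.choose_pos (by omega))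

/-- **`T_n^{(k)}(x) > 0` for `x ≥ 1`, `k ≤ n`, `n ≥ 1`** (and `T_0 = 1 > 0` for `k = 0`). [Rivlin 1974, (1.97); this file, §1318] -/
theorem iterate_derivative_chebyshevT_real_eval_pos {n k : ℕ} (hn : 1 ≤ n) (hk : k ≤ n) {x : ℝ} (hx : 1 ≤ x) : 0 < (derivative^[k] (Polynomial.Chebyshev.T ℝ (n : ℤ))).eval x := by
  refine lt_of_lt_of_le ?_ (iterate_derivative_chebyshevT_real_eval_one_le n k hx)
  obtain ⟨m, rfl⟩ : ∃ m, n = m + 1 := ⟨n - 1, by omega⟩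
  have h := two_mul_iterate_derivative_chebyshevT_eval_one_eq_choose (R := ℝ) m k
  have hpos : (0 : ℝ) < ((k ! * 2 ^ k * ((m + 1 + k).choose (2 * k) + (m + k).choose (2 * k)) : ℕ) : ℝ) := by
    exact_mod_cast Nat.mul_pos (Nat.mul_pos (Nat.factorial_pos k) (pow_pos two_pos k)) (Nat.add_pos_left (Nat.choose_pos (by omega)) _)
  linarith

end Summit.Ventures.HSemireg.Wedge.HankelOuter
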